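import Literature.Analysis.FluidPDE.AxisymmetricLiftR5
import HarnessLib

/-!
# The axisymmetric extension `x ↦ g(r, 0, z)` of an even meridian profile is `C¹`/`C²` on `ℝ³`
# (regularity across the axis of `u_θ/r`, `ω_θ/r` for smooth axisymmetric fields)

Analysis/FluidPDE support file (calculus only; theorems plus the auxiliary maps `hProj`, `axPt`,
`axLift`, `axLiftDeriv`) on the way to `Literature.Analysis.FluidPDE.Wei2016_logModulus_regularity`
(`LeiZhang2017AxisymmetricCriteria.lean`). D. Wei, J. Math. Anal. Appl. 435 (2016) 402–413 =
arXiv:1508.03318, §1: "Due to the regularity of solutions to Navier–Stokes equations,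
`u ∈ C((0,T*); H⁴)`, and `Ω, J ∈ C([0,T*); L²) ∩ C((0,T*); H²)`, `u_θ/r, u_r/r ∈ C((0,T*); H³)`,
`∂ᵣ(u_r/r)|_{r=0} = 0`. Hence, all calculations below are legal" — i.e. the quotients `u_θ/r`,
`ω_θ/r`, `ω_r/r` of a smooth axially symmetric field are smooth ACROSS the axis (Liu–Wang 2009).

The tree proves the `SO(4)`-invariant version of this mechanism for the lift `ℝ³ → ℝ⁵`
(`AxisymmetricLiftR5.lean`: `liftAx g y = g(|P y|, 0, y₄)` is `C¹` for `g ∈ C²` with `∂₀g = 0`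
on `{x₀ = 0}`, `C²` for `g ∈ C⁴` even in `x₀`). This file is the word-for-word `SO(2)` analogue
on `ℝ³` itself: for `g : ℝ³ → ℝ`,

* `Wei2016.hProj x = (x₀, x₁, 0)`, `Wei2016.axPt x = (r(x), 0, x₂)` (`r = |hProj x| = cylRadius x`),
  `Wei2016.axLift g x = g (axPt x)` — for an axisymmetric scalar `G`, `axLift G = G`
  (`IsAxisymmetricScalar.eq_comp_meridian`), and for the even meridian profile `g` of a quotient
  such as `u_θ/r` the function `axLift g` is its extension across the axis;
* `Wei2016.hasFDerivAt_axLift`, `Wei2016.contDiff_one_axLift` (`g ∈ C²`, `∂₀g = 0` on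
  `{x₀ = 0}`), `Wei2016.contDiff_two_axLift` (`g ∈ C⁴` even in `x₀`), by the tree's
  `hasFDerivAt_of_hasFDerivAt_off_ker` (mean value across the axis) and `IsEvenC.liftData`
  (Hadamard quotient of `∂₀g`).

All statements are folklore calculus.

## References

* J.-G. Liu, W.-C. Wang, *Characterization and regularity for axisymmetric solenoidal vector
  fields with application to Navier–Stokes equation*, SIAM J. Math. Anal. 41 (2009) (the
  regularity of `u_θ/r` across the axis). [folklore]
* D. Wei, arXiv:1508.03318, §1 (the regularity paragraph quoted above). [Wei2016]
-/

noncomputable section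

open Set Function Filter Topology WithLp
open scoped RealInnerProductSpace Topology ContDiff

namespace Literature.Analysis.FluidPDE

namespace Wei2016

/-! ### The horizontal projection and the meridian point of `ℝ³` -/

/-- The horizontal projection of `ℝ³`: `P x = x − x₂ e₂ = (x₀, x₁, 0)`. [folklore] -/
def hProj : (EuclideanSpace ℝ (Fin 3)) →L[ℝ] (EuclideanSpace ℝ (Fin 3)) :=
  ContinuousLinearMap.id ℝ (EuclideanSpace ℝ (Fin 3)) -
    (EuclideanSpace.proj (2 : Fin 3) : (EuclideanSpace ℝ (Fin 3)) →L[ℝ] ℝ).smulRight (EuclideanSpace.single 2 (1 : ℝ))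

/-- Coordinates of the horizontal projection. [folklore] -/
theorem hProj_apply (x : (EuclideanSpace ℝ (Fin 3))) (i : Fin 3) : hProj x i = if i = 2 then 0 else x i := by
  simp [hProj, PiLp.single_apply]
  split_ifs with h
  · subst h; ring
  · ring

/-- The last coordinate of the horizontal projection vanishes. [folklore] -/
@[simp] theorem hProj_apply_two (x : (EuclideanSpace ℝ (Fin 3))) : hProj x 2 = 0 := by
  rw [hProj_apply, if_pos rfl]

/-- `(P x)₀ = x₀`. [folklore] -/
@[simp] theorem hProj_apply_zero (x : (EuclideanSpace ℝ (Fin 3))) : hProj x 0 = x 0 := by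
  rw [hProj_apply, if_neg (by decide)]

/-- `(P x)₁ = x₁`. [folklore] -/
@[simp] theorem hProj_apply_one (x : (EuclideanSpace ℝ (Fin 3))) : hProj x 1 = x 1 := by
  rw [hProj_apply, if_neg (by decide)]

/-- `P e₀ = e₀`. [folklore] -/
theorem hProj_single_zero : hProj (EuclideanSpace.single 0 (1 : ℝ)) = EuclideanSpace.single 0 (1 : ℝ) := by
  ext j
  rw [hProj_apply, PiLp.single_apply]
  split_ifs with h1 h2
  · exact absurd (h2.symm.trans h1) (by decide)
  · rfl
  · rfl
  · rfl

/-- `⟪P x, eᵢ⟫ = (P x)ᵢ`. [folklore] -/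
theorem inner_hProj_single (x : (EuclideanSpace ℝ (Fin 3))) (i : Fin 3) :
    ⟪hProj x, EuclideanSpace.single i (1 : ℝ)⟫ = hProj x i := by
  rw [EuclideanSpace.inner_single_right, one_mul, conj_trivial]

/-- Every vector splits as `h = P h + h₂ e₂`. [folklore] -/
theorem hProj_add_smul_single (h : (EuclideanSpace ℝ (Fin 3))) : hProj h + h 2 • EuclideanSpace.single 2 (1 : ℝ) = h := by
  ext j
  rw [PiLp.add_apply, PiLp.smul_apply, hProj_apply, PiLp.single_apply, smul_eq_mul]
  split_ifs with hj
  · subst hj; ring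
  · ring

/-- `⟪P x, P h⟫ = ⟪P x, h⟫`. [folklore] -/
theorem inner_hProj_hProj (x h : (EuclideanSpace ℝ (Fin 3))) : ⟪hProj x, hProj h⟫ = ⟪hProj x, h⟫ := by
  conv_rhs => rw [← hProj_add_smul_single h]
  rw [inner_add_right, inner_smul_right, inner_hProj_single, hProj_apply_two, mul_zero, add_zero]

/-- `|P x| = r(x)` (the cylindrical radius). [folklore] -/
theorem norm_hProj (x : (EuclideanSpace ℝ (Fin 3))) : ‖hProj x‖ = cylRadius x := by
  rw [cylRadius, EuclideanSpace.norm_eq, Fin.sum_univ_three, hProj_apply_zero, hProj_apply_one,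
    hProj_apply_two]
  simp [Real.norm_eq_abs, sq_abs]

/-- `P x = 0` iff `x` is on the axis. [folklore] -/
theorem hProj_eq_zero_iff (x : (EuclideanSpace ℝ (Fin 3))) : hProj x = 0 ↔ cylRadius x = 0 := by
  rw [← norm_hProj, norm_eq_zero]

/-- The meridian point of `x ∈ ℝ³`: `axPt x = (r(x), 0, x₂)`. [folklore] -/
def axPt (x : (EuclideanSpace ℝ (Fin 3))) : (EuclideanSpace ℝ (Fin 3)) :=
  meridianPoint (‖hProj x‖, x 2)

/-- `axPt x = (r, 0, z)` in terms of the accepted `meridian`. [folklore] -/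
theorem axPt_eq_meridianPoint (x : (EuclideanSpace ℝ (Fin 3))) : axPt x = meridianPoint (meridian x) := by
  rw [axPt, norm_hProj, meridian_apply]

/-- First coordinate: `r`. [folklore] -/
@[simp] theorem axPt_apply_zero (x : (EuclideanSpace ℝ (Fin 3))) : axPt x 0 = ‖hProj x‖ := rfl

/-- Second coordinate: `0`. [folklore] -/
@[simp] theorem axPt_apply_one (x : (EuclideanSpace ℝ (Fin 3))) : axPt x 1 = 0 := rfl

/-- Third coordinate: `z = x₂`. [folklore] -/
@[simp] theorem axPt_apply_two (x : (EuclideanSpace ℝ (Fin 3))) : axPt x 2 = x 2 := rfl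

/-- `axPt x = r e₀ + z e₂`. [folklore] -/
theorem axPt_eq (x : (EuclideanSpace ℝ (Fin 3))) :
    axPt x = ‖hProj x‖ • EuclideanSpace.single 0 (1 : ℝ) + x 2 • EuclideanSpace.single 2 (1 : ℝ) := by
  ext j
  fin_cases j
  · simp
  · simp
  · simp

/-- The meridian point depends continuously on `x`. [folklore] -/
theorem continuous_axPt : Continuous axPt :=
  (contDiff_meridianPoint (n := 0)).continuous.comp
    (hProj.continuous.norm.prodMk (EuclideanSpace.proj (2 : Fin 3) : (EuclideanSpace ℝ (Fin 3)) →L[ℝ] ℝ).continuous)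

/-- The derivative of `r = |P x|` off the axis: `⟪P x, ·⟫/|P x|`. [folklore] -/
theorem hasFDerivAt_norm_hProj {x : (EuclideanSpace ℝ (Fin 3))} (hx : hProj x ≠ 0) :
    HasFDerivAt (fun z : (EuclideanSpace ℝ (Fin 3)) => ‖hProj z‖) (‖hProj x‖⁻¹ • innerSL ℝ (hProj x)) x := by
  have h1 : HasFDerivAt (fun z : (EuclideanSpace ℝ (Fin 3)) => ‖hProj z‖ ^ 2) (2 • (innerSL ℝ (hProj x)).comp hProj) x :=
    hProj.hasFDerivAt.norm_sq
  have hne : ‖hProj x‖ ^ 2 ≠ 0 := pow_ne_zero 2 (norm_ne_zero_iff.2 hx)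
  have h2 := h1.sqrt hne
  simp only [Real.sqrt_sq (norm_nonneg _)] at h2
  refine h2.congr_fderiv ?_
  ext h
  simp only [_root_.smul_apply, ContinuousLinearMap.comp_apply, innerSL_apply_apply, smul_eq_mul,
    inner_hProj_hProj, nsmul_eq_mul, Nat.cast_ofNat]
  field_simp

/-- The derivative of the meridian point off the axis: `h ↦ (⟪P x, h⟫/|P x|) e₀ + h₂ e₂`. [folklore] -/
def axDeriv (x : (EuclideanSpace ℝ (Fin 3))) : (EuclideanSpace ℝ (Fin 3)) →L[ℝ] (EuclideanSpace ℝ (Fin 3)) :=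
  (‖hProj x‖⁻¹ • innerSL ℝ (hProj x)).smulRight (EuclideanSpace.single 0 (1 : ℝ)) +
    (EuclideanSpace.proj (2 : Fin 3) : (EuclideanSpace ℝ (Fin 3)) →L[ℝ] ℝ).smulRight (EuclideanSpace.single 2 (1 : ℝ))

/-- Unfolding `axDeriv`. [folklore] -/
theorem axDeriv_apply (x h : (EuclideanSpace ℝ (Fin 3))) :
    axDeriv x h = (‖hProj x‖⁻¹ * ⟪hProj x, h⟫) • EuclideanSpace.single 0 (1 : ℝ) +
      h 2 • EuclideanSpace.single 2 (1 : ℝ) := by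
  simp only [axDeriv, _root_.add_apply, ContinuousLinearMap.smulRight_apply, _root_.smul_apply,
    innerSL_apply_apply, smul_eq_mul, PiLp.proj_apply]

/-- Off the axis the meridian point is differentiable, with derivative `axDeriv x`. [folklore] -/
theorem hasFDerivAt_axPt {x : (EuclideanSpace ℝ (Fin 3))} (hx : hProj x ≠ 0) : HasFDerivAt axPt (axDeriv x) x := by
  have h : axPt = fun z : (EuclideanSpace ℝ (Fin 3)) =>
      ‖hProj z‖ • EuclideanSpace.single 0 (1 : ℝ) + z 2 • EuclideanSpace.single 2 (1 : ℝ) :=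
    funext axPt_eq
  rw [h]
  exact ((hasFDerivAt_norm_hProj hx).smul_const _).add
    ((EuclideanSpace.proj (2 : Fin 3) : (EuclideanSpace ℝ (Fin 3)) →L[ℝ] ℝ).hasFDerivAt.smul_const _)

/-! ### The axisymmetric extension and its first derivative -/

/-- The axisymmetric (`SO(2)`-invariant) extension of `g : ℝ³ → α` from the meridian half-plane:
`axLift g x = g (r(x), 0, x₂)`. For an axisymmetric scalar `G`, `axLift G = G`
(`axLift_eq_self`). [folklore] -/
def axLift {α : Type*} (g : (EuclideanSpace ℝ (Fin 3)) → α) (x : (EuclideanSpace ℝ (Fin 3))) : α :=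
  g (axPt x)

/-- Unfolding `axLift`. [folklore] -/
@[simp] theorem axLift_apply {α : Type*} (g : (EuclideanSpace ℝ (Fin 3)) → α) (x : (EuclideanSpace ℝ (Fin 3))) : axLift g x = g (axPt x) := rfl

/-- An axisymmetric scalar is its own extension: `axLift G = G`. [folklore] -/
theorem axLift_eq_self {α : Type*} {G : (EuclideanSpace ℝ (Fin 3)) → α} (hG : IsAxisymmetricScalar G) : axLift G = G := by
  funext x
  rw [axLift_apply, axPt_eq_meridianPoint, ← hG.eq_comp_meridian x]

/-- The extension of a continuous function is continuous. [folklore] -/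
theorem continuous_axLift {α : Type*} [TopologicalSpace α] {g : (EuclideanSpace ℝ (Fin 3)) → α} (hg : Continuous g) :
    Continuous (axLift g) :=
  hg.comp continuous_axPt

/-- The extension is an axisymmetric scalar. [folklore] -/
theorem isAxisymmetricScalar_axLift {α : Type*} (g : (EuclideanSpace ℝ (Fin 3)) → α) : IsAxisymmetricScalar (axLift g) := by
  intro θ x
  simp only [axLift_apply, axPt, norm_hProj, cylRadius_rotZ, rotZ_apply_two]

/-- The candidate derivative of the extension of a scalar `g`:
`axLiftDeriv g x = q(axPt x) ⟪P x, ·⟫ + ∂₂g(axPt x) (·)₂`, `q = hadamardQuotFst ∂₀g`. [folklore] -/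
def axLiftDeriv (g : (EuclideanSpace ℝ (Fin 3)) → ℝ) (x : (EuclideanSpace ℝ (Fin 3))) : (EuclideanSpace ℝ (Fin 3)) →L[ℝ] ℝ :=
  hadamardQuotFst (fun y => fderiv ℝ g y (EuclideanSpace.single 0 1)) (axPt x) • innerSL ℝ (hProj x) +
    fderiv ℝ g (axPt x) (EuclideanSpace.single 2 1) • (EuclideanSpace.proj (2 : Fin 3) : (EuclideanSpace ℝ (Fin 3)) →L[ℝ] ℝ)

/-- Unfolding `axLiftDeriv`. [folklore] -/
theorem axLiftDeriv_apply (g : (EuclideanSpace ℝ (Fin 3)) → ℝ) (x h : (EuclideanSpace ℝ (Fin 3))) :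
    axLiftDeriv g x h =
      hadamardQuotFst (fun y => fderiv ℝ g y (EuclideanSpace.single 0 1)) (axPt x) * ⟪hProj x, h⟫ +
        fderiv ℝ g (axPt x) (EuclideanSpace.single 2 1) * h 2 := by
  simp only [axLiftDeriv, _root_.add_apply, _root_.smul_apply, innerSL_apply_apply, smul_eq_mul,
    PiLp.proj_apply]

variable {g : (EuclideanSpace ℝ (Fin 3)) → ℝ}

/-- The candidate derivative is continuous for `g ∈ C²`. [folklore] -/
theorem continuous_axLiftDeriv (hg : ContDiff ℝ 2 g) : Continuous (axLiftDeriv g) := by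
  have h0 : ContDiff ℝ 1 fun x => fderiv ℝ g x (EuclideanSpace.single 0 1) :=
    contDiff_fderiv_apply_const_succ (n := 1) (by exact_mod_cast hg) _
  have hq : Continuous (hadamardQuotFst fun x => fderiv ℝ g x (EuclideanSpace.single 0 1)) :=
    (contDiff_hadamardQuotFst (n := 0) (by exact_mod_cast h0)).continuous
  have h2 : Continuous fun x => fderiv ℝ g x (EuclideanSpace.single 2 1) :=
    (contDiff_fderiv_apply_const_succ (n := 1) (by exact_mod_cast hg) _).continuous
  unfold axLiftDeriv
  exact ((hq.comp continuous_axPt).smul ((innerSL ℝ).continuous.comp hProj.continuous)).add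
    ((h2.comp continuous_axPt).smul continuous_const)

/-- **The derivative of the extension off the axis** (chain rule and the Hadamard factorisation
`∂₀g(x) = x₀ q(x)`). [folklore] -/
theorem hasFDerivAt_axLift_of_ne (hg : ContDiff ℝ 2 g)
    (h0 : ∀ x : (EuclideanSpace ℝ (Fin 3)), x 0 = 0 → fderiv ℝ g x (EuclideanSpace.single 0 1) = 0) {x : (EuclideanSpace ℝ (Fin 3))}
    (hx : hProj x ≠ 0) : HasFDerivAt (axLift g) (axLiftDeriv g x) x := by
  have hg1 : ContDiff ℝ 1 fun x => fderiv ℝ g x (EuclideanSpace.single 0 1) :=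
    contDiff_fderiv_apply_const_succ (n := 1) (by exact_mod_cast hg) _
  have hc : HasFDerivAt (axLift g) ((fderiv ℝ g (axPt x)).comp (axDeriv x)) x :=
    ((hg.differentiable (by norm_num)) (axPt x)).hasFDerivAt.comp x (hasFDerivAt_axPt hx)
  refine hc.congr_fderiv ?_
  ext h
  rw [ContinuousLinearMap.comp_apply, axDeriv_apply, map_add, map_smul, map_smul, axLiftDeriv_apply,
    smul_eq_mul, smul_eq_mul]
  congr 1
  · have hq := smul_hadamardQuotFst hg1 h0 (axPt x)
    rw [smul_eq_mul, axPt_apply_zero] at hq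
    rw [← hq]
    have hne : ‖hProj x‖ ≠ 0 := norm_ne_zero_iff.2 hx
    field_simp
  · exact mul_comm _ _

/-- **The derivative of the extension** at every point: for `g ∈ C²` with `∂₀g = 0` on
`{x₀ = 0}`, `D(axLift g)(x) = axLiftDeriv g x`; on the axis by
`hasFDerivAt_of_hasFDerivAt_off_ker`. [folklore] -/
theorem hasFDerivAt_axLift (hg : ContDiff ℝ 2 g)
    (h0 : ∀ x : (EuclideanSpace ℝ (Fin 3)), x 0 = 0 → fderiv ℝ g x (EuclideanSpace.single 0 1) = 0) (x : (EuclideanSpace ℝ (Fin 3))) :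
    HasFDerivAt (axLift g) (axLiftDeriv g x) x := by
  by_cases hx : hProj x = 0
  · exact hasFDerivAt_of_hasFDerivAt_off_ker hProj (continuous_axLift hg.continuous)
      (continuous_axLiftDeriv hg).continuousAt hx
      ⟨EuclideanSpace.single 0 1, by rw [hProj_single_zero]; simp⟩
      fun z hz => hasFDerivAt_axLift_of_ne hg h0 hz
  · exact hasFDerivAt_axLift_of_ne hg h0 hx

/-- The derivative of the extension. [folklore] -/
theorem fderiv_axLift (hg : ContDiff ℝ 2 g)
    (h0 : ∀ x : (EuclideanSpace ℝ (Fin 3)), x 0 = 0 → fderiv ℝ g x (EuclideanSpace.single 0 1) = 0) (x : (EuclideanSpace ℝ (Fin 3))) :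
    fderiv ℝ (axLift g) x = axLiftDeriv g x :=
  (hasFDerivAt_axLift hg h0 x).fderiv

/-- **The extension is `C¹`** for `g ∈ C²` with `∂₀g = 0` on `{x₀ = 0}`. [folklore] -/
theorem contDiff_one_axLift (hg : ContDiff ℝ 2 g)
    (h0 : ∀ x : (EuclideanSpace ℝ (Fin 3)), x 0 = 0 → fderiv ℝ g x (EuclideanSpace.single 0 1) = 0) :
    ContDiff ℝ 1 (axLift g) :=
  contDiff_one_iff_hasFDerivAt.2 ⟨axLiftDeriv g, continuous_axLiftDeriv hg, hasFDerivAt_axLift hg h0⟩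

/-- **The extension is `C²`** for `g ∈ C⁴` even in `x₀` (its derivative
`axLiftDeriv g = (axLift q) ⟪P ·, ·⟫ + (axLift ∂₂g) (·)₂` is `C¹` by the first-order theorem applied
to `q` and `∂₂g`, `IsEvenC.liftData`). [folklore] -/
theorem contDiff_two_axLift (hg : ContDiff ℝ 4 g) (hev : IsEvenC 0 g) : ContDiff ℝ 2 (axLift g) := by
  obtain ⟨hq, hq0, hg₂, hg₂0⟩ := hev.liftData hg
  have hgd : Differentiable ℝ g := hg.differentiable (by norm_num)
  have h0 : ∀ x : (EuclideanSpace ℝ (Fin 3)), x 0 = 0 → fderiv ℝ g x (EuclideanSpace.single 0 1) = 0 := fun x hx =>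
    hev.fderiv_single_zero_eq_zero hgd hx
  have hLq := contDiff_one_axLift hq hq0
  have hL₂ := contDiff_one_axLift (hg₂.of_le (by norm_num)) hg₂0
  have hL : ContDiff ℝ 1 (axLiftDeriv g) := by
    rw [contDiff_clm_apply_iff]
    intro h
    have : (fun y => axLiftDeriv g y h) = fun y =>
        axLift (hadamardQuotFst fun x => fderiv ℝ g x (EuclideanSpace.single 0 1)) y * ⟪hProj y, h⟫ +
          axLift (fun x => fderiv ℝ g x (EuclideanSpace.single 2 1)) y * h 2 :=
      funext fun y => axLiftDeriv_apply g y h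
    rw [this]
    exact (hLq.mul (hProj.contDiff.inner ℝ contDiff_const)).add (hL₂.mul contDiff_const)
  exact contDiff_succ_iff_hasFDerivAt.2 ⟨axLiftDeriv g, hL, hasFDerivAt_axLift (hg.of_le (by norm_num)) h0⟩

/-- **The extension of an axisymmetric scalar's restriction agrees with it**: on the meridian
half-plane `axLift g (ρ, 0, z) = g (ρ, 0, z)` for `ρ ≥ 0`. [folklore] -/
theorem axLift_meridianPoint {α : Type*} (g : (EuclideanSpace ℝ (Fin 3)) → α) {ρ : ℝ} (hρ : 0 ≤ ρ) (z : ℝ) :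
    axLift g (meridianPoint (ρ, z)) = g (meridianPoint (ρ, z)) := by
  rw [axLift_apply, axPt_eq_meridianPoint,
    meridian_meridianPoint (show (0 : ℝ) ≤ (ρ, z).1 from hρ)]

end Wei2016

end Literature.Analysis.FluidPDE

end
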